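import Summits.AtomisticToContinuum.Crystallization.Theorems.PricedLinkCensusTruncatedCensusGapFarPeriodicForm

/-!
# Barlow stackings in the near-window have no far sites

Helper (FAR, non-vacuity of the near-Barlow predicate) for the stub `stub_barlowFarSiteGap`
(FAR, the open core) of the line `near-far-split`
(`Cruxes/TruncatedCensusGap/Lines/near_far_split.lean`) of the crux
`PricedLinkCensus.TruncatedCensusGap` (item stmt-AtomisticToContinuum-14230).

A configuration whose point set IS a Barlow stacking `barlowStacking a c s` with
`a ∈ [93/100, 51/50]`, `c ∈ [78a/100, 86a/100]` and `s` a Hägg word is near-Barlow at every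
site (`nearBarlow_of_range_eq_barlowStacking`: chart `g = id`, exact matching, separation
`min a c ≥ 78a/100 ≥ a/2` by `le_dist_of_mem_barlowStacking`); the same after any rigid
motion (`nearBarlow_of_range_eq_image_barlowStacking`).  Consequently the periodic Barlow
configurations of the window (`barlowPeriodicConfiguration`, any period `p`) have NO far motif
site (`motifFar_barlowPeriodicConfiguration`, registered form), so the periodic far-site
pricing of `…FarPeriodicForm.lean` — i.e. (FAR) — demands nothing of them: on the window the
whole burden of the line is on the near side (N1 strained margin, N2 coercivity, N3 engine), as
designed.  In particular (FAR) is not refuted by any window Barlow stacking, whatever `e_χ*` is.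

All `[folklore]` bookkeeping; the content of (FAR) is untouched.
-/

noncomputable section

namespace Summit.AtomisticToContinuum.Crystallization.Theorems.PricedLinkCensusTruncatedCensusGap

open Literature.MathematicalPhysics.StatisticalMechanics Literature.Geometry.DiscreteGeometry

/-- **A Barlow stacking of the window is near-Barlow at every site**: if the point set of an
injective configuration `y` is `barlowStacking a c s` (`a ∈ [93/100, 51/50]`,
`c ∈ [78a/100, 86a/100]`, `s` Hägg), take the chart `g = id`: the matching is exact and the
separation is `min a c ≥ a/2`. [folklore] -/
theorem nearBarlow_of_range_eq_barlowStacking {ι : Type*} (y : ι → EuclideanSpace ℝ (Fin 3))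
    (hy : Function.Injective y) {a c : ℝ} {s : ℤ → ℤ} (ha : 93 / 100 ≤ a) (ha' : a ≤ 51 / 50)
    (hc : 78 / 100 * a ≤ c) (hc' : c ≤ 86 / 100 * a) (hs : IsHaggSeq s)
    (hrange : Set.range y = barlowStacking a c s) (i : ι) :
    ∃ (a c : ℝ) (s : ℤ → ℤ) (g : EuclideanSpace ℝ (Fin 3) ≃ᵃⁱ[ℝ] EuclideanSpace ℝ (Fin 3)), 93 / 100 ≤ a ∧ a ≤ 51 / 50 ∧ 78 / 100 * a ≤ c ∧ c ≤ 86 / 100 * a ∧ Literature.MathematicalPhysics.StatisticalMechanics.IsHaggSeq s ∧ (∀ j k, j ≠ k → dist (y j) (y i) ≤ 3 * a → a / 2 ≤ dist (y j) (y k)) ∧ (∀ j, dist (y j) (y i) ≤ 3 * a → ∃ z ∈ Literature.MathematicalPhysics.StatisticalMechanics.barlowStacking a c s, dist (y j) (g z) ≤ a / 50) ∧ (∀ z ∈ Literature.MathematicalPhysics.StatisticalMechanics.barlowStacking a c s, dist (g z) (y i) ≤ 3 * a → ∃ j, dist (y j) (g z) ≤ a / 50) := by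
  refine ⟨a, c, s, AffineIsometryEquiv.refl ℝ (EuclideanSpace ℝ (Fin 3)), ha, ha', hc, hc', hs, ?_, ?_, ?_⟩
  · intro j k hjk _
    have hj : y j ∈ barlowStacking a c s := hrange ▸ Set.mem_range_self j
    have hk : y k ∈ barlowStacking a c s := hrange ▸ Set.mem_range_self k
    have hmin : min a c ≤ dist (y j) (y k) :=
      le_dist_of_mem_barlowStacking a c s (by linarith) (by linarith) hj hk (hy.ne hjk)
    have : a / 2 ≤ min a c := le_min (by linarith) (by linarith)
    exact this.trans hmin
  · intro j _
    refine ⟨y j, hrange ▸ Set.mem_range_self j, ?_⟩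
    simp only [AffineIsometryEquiv.coe_refl, id_eq, dist_self]
    linarith
  · intro z hz _
    rw [← hrange] at hz
    obtain ⟨j, rfl⟩ := hz
    refine ⟨j, ?_⟩
    simp only [AffineIsometryEquiv.coe_refl, id_eq, dist_self]
    linarith

/-- The same for a rigidly moved window Barlow stacking `φ '' barlowStacking a c s`. [folklore] -/
theorem nearBarlow_of_range_eq_image_barlowStacking {ι : Type*} (y : ι → EuclideanSpace ℝ (Fin 3))
    (hy : Function.Injective y) {a c : ℝ} {s : ℤ → ℤ} (ha : 93 / 100 ≤ a) (ha' : a ≤ 51 / 50)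
    (hc : 78 / 100 * a ≤ c) (hc' : c ≤ 86 / 100 * a) (hs : IsHaggSeq s)
    (φ : EuclideanSpace ℝ (Fin 3) ≃ᵃⁱ[ℝ] EuclideanSpace ℝ (Fin 3)) (hrange : Set.range y = ⇑φ '' barlowStacking a c s) (i : ι) :
    ∃ (a c : ℝ) (s : ℤ → ℤ) (g : EuclideanSpace ℝ (Fin 3) ≃ᵃⁱ[ℝ] EuclideanSpace ℝ (Fin 3)), 93 / 100 ≤ a ∧ a ≤ 51 / 50 ∧ 78 / 100 * a ≤ c ∧ c ≤ 86 / 100 * a ∧ Literature.MathematicalPhysics.StatisticalMechanics.IsHaggSeq s ∧ (∀ j k, j ≠ k → dist (y j) (y i) ≤ 3 * a → a / 2 ≤ dist (y j) (y k)) ∧ (∀ j, dist (y j) (y i) ≤ 3 * a → ∃ z ∈ Literature.MathematicalPhysics.StatisticalMechanics.barlowStacking a c s, dist (y j) (g z) ≤ a / 50) ∧ (∀ z ∈ Literature.MathematicalPhysics.StatisticalMechanics.barlowStacking a c s, dist (g z) (y i) ≤ 3 * a → ∃ j, dist (y j) (g z) ≤ a / 50) := by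
  have hcomp : (⇑φ ∘ (⇑φ.symm ∘ y)) = y := by
    funext j
    simp
  have hy' : Function.Injective (⇑φ.symm ∘ y) := φ.symm.injective.comp hy
  have hrange' : Set.range (⇑φ.symm ∘ y) = barlowStacking a c s := by
    rw [Set.range_comp, hrange, ← Set.image_comp]
    simp
  have h := nearBarlow_of_range_eq_barlowStacking (⇑φ.symm ∘ y) hy' ha ha' hc hc' hs hrange' i
  have h' := nearBarlow_isometry_comp_of φ (⇑φ.symm ∘ y) i h
  rwa [hcomp] at h'

/-- **Window Barlow stackings have no far motif site** (registered form): for the periodic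
Barlow configuration `barlowPeriodicConfiguration w ha hh hp hw` (Hägg word `w` of any period
`p`) with `a₀ ∈ [93/100, 51/50]`, `h₀ ∈ [78a₀/100, 86a₀/100]`, the number of motif sites that are
far in its point set is `0` — so the periodic far-site pricing, i.e. (FAR), is vacuous on them.
[folklore] -/
theorem motifFar_barlowPeriodicConfiguration : ∀ (a₀ h₀ : ℝ) (w : ℤ → ℤ) (p : ℕ) (ha : a₀ ≠ 0) (hh : h₀ ≠ 0) (hp : p ≠ 0) (hw : ∀ i : ℤ, w (i + p) = w i), 93 / 100 ≤ a₀ → a₀ ≤ 51 / 50 → 78 / 100 * a₀ ≤ h₀ → h₀ ≤ 86 / 100 * a₀ → Literature.MathematicalPhysics.StatisticalMechanics.IsHaggSeq w → Nat.card {x : (Literature.MathematicalPhysics.StatisticalMechanics.barlowPeriodicConfiguration w ha hh hp hw).motif // ¬ ∃ (a c : ℝ) (s : ℤ → ℤ) (g : EuclideanSpace ℝ (Fin 3) ≃ᵃⁱ[ℝ] EuclideanSpace ℝ (Fin 3)), 93 / 100 ≤ a ∧ a ≤ 51 / 50 ∧ 78 / 100 * a ≤ c ∧ c ≤ 86 /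 100 * a ∧ Literature.MathematicalPhysics.StatisticalMechanics.IsHaggSeq s ∧ (∀ j k : (Literature.MathematicalPhysics.StatisticalMechanics.barlowPeriodicConfiguration w ha hh hp hw).points, j ≠ k → dist ((Subtype.val : (Literature.MathematicalPhysics.StatisticalMechanics.barlowPeriodicConfiguration w ha hh hp hw).points → EuclideanSpace ℝ (Fin 3)) j) ((Subtype.val : (Literature.MathematicalPhysics.StatisticalMechanics.barlowPeriodicConfiguration w ha hh hp hw).points → EuclideanSpace ℝ (Fin 3)) ⟨x.1, (Literature.MathematicalPhysics.StatisticalMechanics.barlowPeriodicConfiguration w ha hh hp hw).mem_points_of_mem_motif x.2⟩) ≤ 3 * a → a / 2 ≤ dist ((Subtype.val : (Literature.MathematicalPhysics.StatisticalMechanics.barlowPeriodicConfiguration w ha hh hp hw).points → EuclideanSpace ℝ (Fin 3)) j) ((Subtype.val : (Literature.MathematicalPhysics.StatisticalMechanics.barlowPeriodicConfiguration w ha hh hp hw).points → EuclideanSpace ℝ (Fin 3)) k)) ∧ (∀ j : (Literature.MathematicalPhysics.StatisticalMechanics.barlowPeriodicConfiguration w ha hh hp hw).points, dist ((Subtype.val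 : (Literature.MathematicalPhysics.StatisticalMechanics.barlowPeriodicConfiguration w ha hh hp hw).points → EuclideanSpace ℝ (Fin 3)) j) ((Subtype.val : (Literature.MathematicalPhysics.StatisticalMechanics.barlowPeriodicConfiguration w ha hh hp hw).points → EuclideanSpace ℝ (Fin 3)) ⟨x.1, (Literature.MathematicalPhysics.StatisticalMechanics.barlowPeriodicConfiguration w ha hh hp hw).mem_points_of_mem_motif x.2⟩) ≤ 3 * a → ∃ z ∈ Literature.MathematicalPhysics.StatisticalMechanics.barlowStacking a c s, dist ((Subtype.val : (Literature.MathematicalPhysics.StatisticalMechanics.barlowPeriodicConfiguration w ha hh hp hw).points → EuclideanSpace ℝ (Fin 3)) j) (g z) ≤ a / 50) ∧ (∀ z ∈ Literature.MathematicalPhysics.StatisticalMechanics.barlowStacking a c s, dist (g z) ((Subtype.val : (Literature.MathematicalPhysics.StatisticalMechanics.barlowPeriodicConfiguration w ha hh hp hw).points → EuclideanSpace ℝ (Fin 3)) ⟨x.1, (Literature.MathematicalPhysics.StatisticalMechanics.barlowPeriodicConfiguration w ha hh hp hw).mem_points_of_mem_motif x.2⟩) ≤ 3 * a → ∃ j :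 (Literature.MathematicalPhysics.StatisticalMechanics.barlowPeriodicConfiguration w ha hh hp hw).points, dist ((Subtype.val : (Literature.MathematicalPhysics.StatisticalMechanics.barlowPeriodicConfiguration w ha hh hp hw).points → EuclideanSpace ℝ (Fin 3)) j) (g z) ≤ a / 50)} = 0 := by
  intro a₀ h₀ w p ha hh hp hw ha1 ha2 hh1 hh2 hwH
  rw [Nat.card_eq_zero]
  left
  refine ⟨fun x => x.2 ?_⟩
  have hrange : Set.range (Subtype.val : (Literature.MathematicalPhysics.StatisticalMechanics.barlowPeriodicConfiguration w ha hh hp hw).points → EuclideanSpace ℝ (Fin 3)) = barlowStacking a₀ h₀ w := by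
    rw [Subtype.range_coe_subtype, Set.setOf_mem_eq, barlowPeriodicConfiguration_points]
  exact nearBarlow_of_range_eq_barlowStacking (Subtype.val : (Literature.MathematicalPhysics.StatisticalMechanics.barlowPeriodicConfiguration w ha hh hp hw).points → EuclideanSpace ℝ (Fin 3)) Subtype.val_injective ha1 ha2 hh1 hh2
    hwH hrange _

/-- Hence, under (FAR), the periodic far-site pricing says nothing about window Barlow
stackings: their priced far count vanishes, whatever the periodic infimum `e_χ*` is (the
inequality `κ · 0 ≤ #F · (e_χ(Q) − e_χ*)` is the free `κ = 0` half). [folklore] -/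
theorem periodicFarPricing_barlow_trivial (κ : ℝ) (a₀ h₀ : ℝ) (w : ℤ → ℤ) (p : ℕ)
    (ha : a₀ ≠ 0) (hh : h₀ ≠ 0) (hp : p ≠ 0) (hw : ∀ i : ℤ, w (i + p) = w i)
    (ha1 : 93 / 100 ≤ a₀) (ha2 : a₀ ≤ 51 / 50) (hh1 : 78 / 100 * a₀ ≤ h₀)
    (hh2 : h₀ ≤ 86 / 100 * a₀) (hwH : IsHaggSeq w) :
    κ * (Nat.card {x : (Literature.MathematicalPhysics.StatisticalMechanics.barlowPeriodicConfiguration w ha hh hp hw).motif // ¬ ∃ (a c : ℝ) (s : ℤ → ℤ) (g : EuclideanSpace ℝ (Fin 3) ≃ᵃⁱ[ℝ] EuclideanSpace ℝ (Fin 3)), 93 / 100 ≤ a ∧ a ≤ 51 / 50 ∧ 78 / 100 * a ≤ c ∧ c ≤ 86 / 100 * a ∧ Literature.MathematicalPhysics.StatisticalMechanics.IsHaggSeq s ∧ (∀ j k : (Literature.MathematicalPhysics.StatisticalMechanics.barlowPeriodicConfiguration w ha hh hp hw).points, j ≠ k → dist ((Subtype.val : (Literature.MathematicalPhysics.StatisticalMechanics.barlowPeriodicConfiguration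 w ha hh hp hw).points → EuclideanSpace ℝ (Fin 3)) j) ((Subtype.val : (Literature.MathematicalPhysics.StatisticalMechanics.barlowPeriodicConfiguration w ha hh hp hw).points → EuclideanSpace ℝ (Fin 3)) ⟨x.1, (Literature.MathematicalPhysics.StatisticalMechanics.barlowPeriodicConfiguration w ha hh hp hw).mem_points_of_mem_motif x.2⟩) ≤ 3 * a → a / 2 ≤ dist ((Subtype.val : (Literature.MathematicalPhysics.StatisticalMechanics.barlowPeriodicConfiguration w ha hh hp hw).points → EuclideanSpace ℝ (Fin 3)) j) ((Subtype.val : (Literature.MathematicalPhysics.StatisticalMechanics.barlowPeriodicConfiguration w ha hh hp hw).points → EuclideanSpace ℝ (Fin 3)) k)) ∧ (∀ j : (Literature.MathematicalPhysics.StatisticalMechanics.barlowPeriodicConfiguration w ha hh hp hw).points, dist ((Subtype.val : (Literature.MathematicalPhysics.StatisticalMechanics.barlowPeriodicConfiguration w ha hh hp hw).points → EuclideanSpace ℝ (Fin 3)) j) ((Subtype.val : (Literature.MathematicalPhysics.StatisticalMechanics.barlowPeriodicConfiguration w ha hh hp hw).points → EuclideanSpace ℝ (Fin 3)) ⟨x.1,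 (Literature.MathematicalPhysics.StatisticalMechanics.barlowPeriodicConfiguration w ha hh hp hw).mem_points_of_mem_motif x.2⟩) ≤ 3 * a → ∃ z ∈ Literature.MathematicalPhysics.StatisticalMechanics.barlowStacking a c s, dist ((Subtype.val : (Literature.MathematicalPhysics.StatisticalMechanics.barlowPeriodicConfiguration w ha hh hp hw).points → EuclideanSpace ℝ (Fin 3)) j) (g z) ≤ a / 50) ∧ (∀ z ∈ Literature.MathematicalPhysics.StatisticalMechanics.barlowStacking a c s, dist (g z) ((Subtype.val : (Literature.MathematicalPhysics.StatisticalMechanics.barlowPeriodicConfiguration w ha hh hp hw).points → EuclideanSpace ℝ (Fin 3)) ⟨x.1, (Literature.MathematicalPhysics.StatisticalMechanics.barlowPeriodicConfiguration w ha hh hp hw).mem_points_of_mem_motif x.2⟩) ≤ 3 * a → ∃ j : (Literature.MathematicalPhysics.StatisticalMechanics.barlowPeriodicConfiguration w ha hh hp hw).points, dist ((Subtype.val : (Literature.MathematicalPhysics.StatisticalMechanics.barlowPeriodicConfiguration w ha hh hp hw).points → EuclideanSpace ℝ (Fin 3)) j) (g z) ≤ a / 50)} : ℝ) = 0 := by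
  rw [motifFar_barlowPeriodicConfiguration a₀ h₀ w p ha hh hp hw ha1 ha2 hh1 hh2 hwH]
  simp

end Summit.AtomisticToContinuum.Crystallization.Theorems.PricedLinkCensusTruncatedCensusGap

end
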